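import Summits.BirchSwinnertonDyer.BirchSwinnertonDyer.Theorems.ManinLocalTwoThreeManinThreeKummerCube
import Summits.BirchSwinnertonDyer.BirchSwinnertonDyer.Theorems.ManinLocalTwoThreeManinOddOfReducibleOfCuspidalKummer
import Summits.BirchSwinnertonDyer.Rank1Residual.ManinAdditive.CuspidalKummerCubeLaws
import HarnessLib

/-!
# LAW₃ is a CUBE criterion: modulo K_geo₃, `CuspidalKummerCubeExponentLaw` ⟺ «`Θ_T` is never a `3`-adic cube»

Summit `BirchSwinnertonDyer`, route `ManinLocalTwoThree` (cell bsd-f2-manin), crux C3 `ManinPrimeToThreeAtNine`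
(stmt-BirchSwinnertonDyer-22968), line `kato_shift_three` (skeleton v8 of record), stub 4 `stub_cubeExponentLaw` =
LAW₃ `CuspidalKummerThree.CuspidalKummerCubeExponentLaw` (every cuspidal Kummer CUBE representative `(r, g, A, B)` of the
tangent-line Kummer series `Θ_T` of a rational `3`-torsion point of an `X₀(N)`-optimal `W`, `9 ∣ N`, has an `η`-exponent
`r_δ ≢ 0 (mod 3)`).  THIS FILE (lead p1, gen 5) shows that LAW₃ is a statement about `Θ_T` ALONE:

* `forall_three_dvd_of_isThreeAdicFracCube` — if `Θ(0) ≠ 0` and `Θ` is a cube in `Frac ℤ₃⟦q⟧`, then EVERY cuspidal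
  cube representative of `Θ` has all exponents `≡ 0 (mod 3)` (the UFD step of p2's
  `maninPrimeToThreeOfEtaExponent_of_maninThreeKummerCube` with E-an-55's conclusion as the hypothesis; E-an-56 `⇒`);
* `isThreeAdicFracCube_of_forall_three_dvd` — conversely a cuspidal cube representative with all exponents `≡ 0 (mod 3)`
  makes `Θ` a cube in `Frac ℤ₃⟦q⟧` (E-an-56 `⇐`: `g = h³` in `ℤ₃⟦q⟧`; `q`-orders give `n₁ ≡ n₂ (mod 3)` because
  `Θ(0) ≠ 0`);
* hence, with `Θ_T(0) = −1` (`constantCoeff_kummerCubeSeries`): LAW₃ at a datum holds for every representative as soon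
  as `Θ_T` is not a `3`-adic cube (`exists_not_three_dvd_of_not_isThreeAdicFracCube`), so
  **NOCUBE₃ ⟹ LAW₃** (`cuspidalKummerCubeExponentLaw_of_noCube`) and **LAW₃ ∧ K_geo₃ (E-an-57) ⟹ NOCUBE₃**
  (`noCube_of_cuspidalKummerCubeExponentLaw_of_representative`), where NOCUBE₃ (stated inline, LAW₃'s binders verbatim)
  says: for `X₀(N)`-optimal `W`, `9 ∣ N`, a rational `3`-torsion point `T` of the short model and the formal germ `z`,
  `Θ_T` is NOT a cube in `Frac ℤ₃⟦q⟧`;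
* and NOCUBE₃ ⟹ `3 ∤ c` on that locus directly through E-an-55 (`ManinThreeKummerCube_holds`, p3):
  `not_three_dvd_maninConstant_of_noCube`.

So the open content of stub 4 is exactly NOCUBE₃; the sibling file on `3`-blindness splits NOCUBE₃ at `3 ∤ c` into a
`c`-free OPTIMALITY law NB₃ and C3 on the locus.  CONDITIONAL edges and criteria only; nothing about BSD or Manin's
conjecture is proved. [folklore]
-/

set_option autoImplicit false
set_option linter.dupNamespace false

noncomputable section

open scoped Classical
open PowerSeries WeierstrassCurve Literature.NumberTheory.EllipticCurves Literature.NumberTheory.EllipticCurves.ModularForms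
  Literature.RingTheory.FormalGroups
open Summit.BirchSwinnertonDyer.Rank1Residual.ManinAdditive.CuspidalKummer
  Summit.BirchSwinnertonDyer.Rank1Residual.ManinAdditive.CuspidalKummerThree

namespace Summit.BirchSwinnertonDyer.BirchSwinnertonDyer.Theorems.ManinLocalTwoThree

/-! ### §1 Algebra: `q`-order bookkeeping with explicit witnesses, and `Θ_T(0) = −1` -/

/-- Order bookkeeping with EXPLICIT witnesses: from `Xᵃ·u·Fᵏ = Xᵇ·Gᵏ` in a power-series domain with `u(0)` a unit and
`F, G ≠ 0`, there are `m, m'` with `u·(X^m F)ᵏ = (X^{m'} G)ᵏ` (so integrality of `F, G` is preserved). [folklore] -/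
theorem exists_mul_X_pow_mul_pow_eq_of_X_pow {R : Type*} [CommRing R] [IsDomain R] {u F G : R⟦X⟧} {a b k : ℕ}
    (hk : 0 < k) (hu : IsUnit u) (hF : F ≠ 0) (hG : G ≠ 0) (h : X ^ a * u * F ^ k = X ^ b * G ^ k) :
    ∃ m m' : ℕ, u * (X ^ m * F) ^ k = (X ^ m' * G) ^ k := by
  have hord := congrArg PowerSeries.order h
  rw [order_mul, order_mul, order_X_pow, order_zero_of_unit hu, add_zero, order_pow, order_mul,
    order_X_pow, order_pow, ← coe_toNat_order hF, ← coe_toNat_order hG] at hord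
  set kF := F.order.toNat
  set kG := G.order.toNat
  have hnat : a + k * kF = b + k * kG := by
    have : ((a + k * kF : ℕ) : ℕ∞) = ((b + k * kG : ℕ) : ℕ∞) := by
      push_cast
      simpa [smul_eq_mul] using hord
    exact_mod_cast this
  have hX : ∀ n : ℕ, (X : R⟦X⟧) ^ n ≠ 0 := fun n => pow_ne_zero n X_ne_zero
  have _ := hk
  rcases le_total a b with hab | hab
  · obtain ⟨d, rfl⟩ := Nat.exists_eq_add_of_le hab
    have hdvd : k ∣ d := by
      have h1 : k ∣ d + k * kG := ⟨kF, by linarith⟩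
      exact (Nat.dvd_add_left (dvd_mul_right k kG)).mp h1
    obtain ⟨m, rfl⟩ := hdvd
    refine ⟨0, m, ?_⟩
    have h' : X ^ a * (u * (X ^ 0 * F) ^ k) = X ^ a * ((X ^ m * G) ^ k) := by
      rw [pow_zero, one_mul, ← mul_assoc, h, pow_add, pow_mul]; ring
    exact mul_left_cancel₀ (hX a) h'
  · obtain ⟨d, rfl⟩ := Nat.exists_eq_add_of_le hab
    have hdvd : k ∣ d := by
      have h1 : k ∣ d + k * kF := ⟨kG, by linarith⟩
      exact (Nat.dvd_add_left (dvd_mul_right k kF)).mp h1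
    obtain ⟨m, rfl⟩ := hdvd
    refine ⟨m, 0, ?_⟩
    have h' : X ^ b * (u * (X ^ m * F) ^ k) = X ^ b * (X ^ 0 * G) ^ k := by
      rw [pow_zero, one_mul, ← h, pow_add, pow_mul]; ring
    exact mul_left_cancel₀ (hX b) h'

/-- `Θ_T(0) = −1`: the tangent-line Kummer series `z³·(y(z) − Y₀ − α(x(z) − X₀))` has constant term `−1` whenever the
germ `z` has no constant term (`z³y(z) = −1 + …`). [Silverman AEC IV.1] [folklore] -/
theorem constantCoeff_kummerCubeSeries (W : WeierstrassCurve ℚ) (c : ℤ) (X₀ Y₀ : ℚ) {z : ℚ⟦X⟧}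
    (hz0 : constantCoeff z = 0) : constantCoeff (kummerCubeSeries W c X₀ Y₀ z) = -1 := by
  rw [kummerCubeSeries, map_sub, map_sub,
    Literature.RingTheory.FormalGroups.constantCoeff_subst_of_constantCoeff_eq_zero hz0,
    constantCoeff_formalYMulCube', smul_eq_C_mul, smul_eq_C_mul, smul_eq_C_mul, map_mul, map_pow, hz0,
    map_mul, map_sub, map_mul, map_mul, map_pow, hz0]
  simp

/-! ### §2 A `3`-adic cube has only representatives with exponents `≡ 0 (mod 3)` -/

/-- **Cube ⟹ all `η`-exponents `≡ 0 (mod 3)`.**  If `Θ ∈ ℚ⟦q⟧` with `Θ(0) ≠ 0` is a cube in `Frac ℤ₃⟦q⟧`, then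
every cuspidal Kummer cube representative `(r, g, A, B)` of `Θ` at level `N` has `3 ∣ r_δ` for all `δ ∣ N`
(`Θ·B′³ = A′³` and `Θ·B³·qⁿ¹ = qⁿ²·g·A³` give `qⁿ²·g·(AB′)³ = qⁿ¹·(A′B)³` in `ℤ₃⟦q⟧`, so `g` is a cube there — orders
and the UFD step — and E-an-56 `etaUnitCubeIffThree_holds` reads the exponents).  The UFD step of p2's
`maninPrimeToThreeOfEtaExponent_of_maninThreeKummerCube`, with the cube as the hypothesis. [folklore] -/
theorem forall_three_dvd_of_isThreeAdicFracCube {N : ℕ} [NeZero N] {Θ : ℚ⟦X⟧} (hΘ0 : constantCoeff Θ ≠ 0)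
    (hcube : IsThreeAdicFracCube Θ) {r : ℕ → ℤ} {g A B : ℤ⟦X⟧} (hrep : IsCuspidalKummerCubeRep N Θ r g A B) :
    ∀ δ ∈ N.divisors, (3 : ℤ) ∣ r δ := by
  obtain ⟨-, hEta, hB0, -, n₁, n₂, -, hEq⟩ := hrep
  obtain ⟨A', B', hB', hcube⟩ := hcube
  have hcompat : ∀ P : ℤ⟦X⟧, PowerSeries.map (Rat.castHom ℚ_[3]) (PowerSeries.map (Int.castRingHom ℚ) P) =
      PowerSeries.map PadicInt.Coe.ringHom (PowerSeries.map (Int.castRingHom ℤ_[3]) P) := fun P => by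
    rw [map_map_apply, map_map_apply,
      Subsingleton.elim ((Rat.castHom ℚ_[3]).comp (Int.castRingHom ℚ))
        ((PadicInt.Coe.ringHom (p := 3)).comp (Int.castRingHom ℤ_[3]))]
  have hκinj : Function.Injective (PowerSeries.map (PadicInt.Coe.ringHom (p := 3))) :=
    PowerSeries.map_injective _ (fun x y h => PadicInt.ext h)
  have hιQinj : Function.Injective (PowerSeries.map (Int.castRingHom ℚ)) :=
    PowerSeries.map_injective _ (RingHom.injective_int _)
  have hιZinj : Function.Injective (PowerSeries.map (Int.castRingHom ℤ_[3])) :=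
    PowerSeries.map_injective _ (RingHom.injective_int _)
  have hΘne : Θ ≠ 0 := fun h => by rw [h, map_zero] at hΘ0; exact hΘ0 rfl
  have hAne : A ≠ 0 := by
    intro hA
    rw [hA] at hEq
    simp only [zero_pow three_ne_zero, mul_zero, map_zero] at hEq
    rcases mul_eq_zero.mp hEq with h | h
    · rcases mul_eq_zero.mp h with h | h
      · exact hΘne h
      · exact hB0 (hιQinj (by rw [map_zero]; exact (pow_eq_zero_iff three_ne_zero).mp h))
    · exact X_ne_zero ((pow_eq_zero_iff' ).mp h).1
  set gZ : ℤ_[3]⟦X⟧ := PowerSeries.map (Int.castRingHom ℤ_[3]) g with hgZ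
  set AZ : ℤ_[3]⟦X⟧ := PowerSeries.map (Int.castRingHom ℤ_[3]) A with hAZ
  set BZ : ℤ_[3]⟦X⟧ := PowerSeries.map (Int.castRingHom ℤ_[3]) B with hBZ
  have hE1 : PowerSeries.map (Rat.castHom ℚ_[3]) Θ * PowerSeries.map PadicInt.Coe.ringHom BZ ^ 3 * X ^ n₁ =
      X ^ n₂ * PowerSeries.map PadicInt.Coe.ringHom gZ * PowerSeries.map PadicInt.Coe.ringHom AZ ^ 3 := by
    have h := congrArg (PowerSeries.map (Rat.castHom ℚ_[3])) hEq
    simp only [map_mul, map_pow, PowerSeries.map_X, hcompat] at h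
    exact h
  have hR : X ^ n₂ * gZ * (AZ * B') ^ 3 = X ^ n₁ * (A' * BZ) ^ 3 := by
    apply hκinj
    simp only [map_mul, map_pow, PowerSeries.map_X]
    linear_combination (-(PowerSeries.map PadicInt.Coe.ringHom B') ^ 3) * hE1 +
      X ^ n₁ * (PowerSeries.map PadicInt.Coe.ringHom BZ) ^ 3 * hcube
  have hgU : IsUnit gZ := by
    rw [isUnit_iff_constantCoeff, hgZ, ← coeff_zero_eq_constantCoeff, coeff_map,
      coeff_zero_eq_constantCoeff, hEta.1, map_one]
    exact isUnit_one
  have hFne : AZ * B' ≠ 0 :=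
    mul_ne_zero (fun h => hAne (hιZinj (by rw [map_zero]; exact h))) hB'
  have hGne : A' * BZ ≠ 0 := by
    intro h0
    rw [h0, zero_pow three_ne_zero, mul_zero] at hR
    exact (mul_ne_zero (mul_ne_zero (pow_ne_zero _ X_ne_zero) hgU.ne_zero) (pow_ne_zero 3 hFne)) hR
  obtain ⟨F', G', hF', h'⟩ := exists_mul_pow_eq_pow_of_X_pow three_pos hgU hFne hGne hR
  obtain ⟨hc, hhc⟩ := exists_eq_pow_of_mul_pow_eq_pow three_pos hF' h'
  have h0 : (0 : ℕ) ∉ N.divisors := fun h =>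
    (NeZero.ne N) (Nat.eq_zero_of_zero_dvd (Nat.mem_divisors.mp h).1)
  exact (etaUnitCubeIffThree_holds N.divisors r g h0 hEta).mp ⟨hc, hhc⟩

/-! ### §3 Conversely: a representative with all exponents `≡ 0 (mod 3)` makes `Θ` a `3`-adic cube -/

/-- **All `η`-exponents `≡ 0 (mod 3)` ⟹ cube.**  If `Θ(0) ≠ 0` and `Θ` has a cuspidal Kummer cube representative
`(r, g, A, B)` at level `N` with `3 ∣ r_δ` for every `δ ∣ N`, then `Θ` is a cube in `Frac ℤ₃⟦q⟧`: E-an-56 gives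
`g = h³` in `ℤ₃⟦q⟧`, so `qⁿ¹·Θ·B³ = qⁿ²·(hA)³`, and comparing `q`-orders (`Θ(0) ≠ 0`) moves the powers of `q` into
the cubes. [folklore] -/
theorem isThreeAdicFracCube_of_forall_three_dvd {N : ℕ} [NeZero N] {Θ : ℚ⟦X⟧} (hΘ0 : constantCoeff Θ ≠ 0)
    {r : ℕ → ℤ} {g A B : ℤ⟦X⟧} (hrep : IsCuspidalKummerCubeRep N Θ r g A B)
    (hall : ∀ δ ∈ N.divisors, (3 : ℤ) ∣ r δ) : IsThreeAdicFracCube Θ := by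
  obtain ⟨-, hEta, hB0, -, n₁, n₂, -, hEq⟩ := hrep
  have h0 : (0 : ℕ) ∉ N.divisors := fun h =>
    (NeZero.ne N) (Nat.eq_zero_of_zero_dvd (Nat.mem_divisors.mp h).1)
  obtain ⟨hc, hhc⟩ := (etaUnitCubeIffThree_holds N.divisors r g h0 hEta).mpr hall
  have hcompat : ∀ P : ℤ⟦X⟧, PowerSeries.map (Rat.castHom ℚ_[3]) (PowerSeries.map (Int.castRingHom ℚ) P) =
      PowerSeries.map PadicInt.Coe.ringHom (PowerSeries.map (Int.castRingHom ℤ_[3]) P) := fun P => by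
    rw [map_map_apply, map_map_apply,
      Subsingleton.elim ((Rat.castHom ℚ_[3]).comp (Int.castRingHom ℚ))
        ((PadicInt.Coe.ringHom (p := 3)).comp (Int.castRingHom ℤ_[3]))]
  have hκinj : Function.Injective (PowerSeries.map (PadicInt.Coe.ringHom (p := 3))) :=
    PowerSeries.map_injective _ (fun x y h => PadicInt.ext h)
  have hιQinj : Function.Injective (PowerSeries.map (Int.castRingHom ℚ)) :=
    PowerSeries.map_injective _ (RingHom.injective_int _)
  have hιZinj : Function.Injective (PowerSeries.map (Int.castRingHom ℤ_[3])) :=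
    PowerSeries.map_injective _ (RingHom.injective_int _)
  have hΘne : Θ ≠ 0 := fun h => by rw [h, map_zero] at hΘ0; exact hΘ0 rfl
  have hAne : A ≠ 0 := by
    intro hA
    rw [hA] at hEq
    simp only [zero_pow three_ne_zero, mul_zero, map_zero] at hEq
    rcases mul_eq_zero.mp hEq with h | h
    · rcases mul_eq_zero.mp h with h | h
      · exact hΘne h
      · exact hB0 (hιQinj (by rw [map_zero]; exact (pow_eq_zero_iff three_ne_zero).mp h))
    · exact X_ne_zero ((pow_eq_zero_iff' ).mp h).1
  set Θ₃ : ℚ_[3]⟦X⟧ := PowerSeries.map (Rat.castHom ℚ_[3]) Θ with hΘ₃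
  set AZ : ℤ_[3]⟦X⟧ := PowerSeries.map (Int.castRingHom ℤ_[3]) A with hAZ
  set BZ : ℤ_[3]⟦X⟧ := PowerSeries.map (Int.castRingHom ℤ_[3]) B with hBZ
  have hgZ : PowerSeries.map (Int.castRingHom ℤ_[3]) g = hc ^ 3 := hhc
  -- the equation in `ℚ₃⟦X⟧`: `X^{n₁} · Θ₃ · (BZ)³ = X^{n₂} · (hc·AZ)³`
  have hE1 : X ^ n₁ * Θ₃ * PowerSeries.map PadicInt.Coe.ringHom BZ ^ 3 =
      X ^ n₂ * PowerSeries.map PadicInt.Coe.ringHom (hc * AZ) ^ 3 := by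
    have h := congrArg (PowerSeries.map (Rat.castHom ℚ_[3])) hEq
    simp only [map_mul, map_pow, PowerSeries.map_X, hcompat, hgZ] at h
    rw [map_mul, mul_pow]
    linear_combination h
  have hΘ₃u : IsUnit Θ₃ := by
    rw [isUnit_iff_constantCoeff, hΘ₃, ← coeff_zero_eq_constantCoeff, coeff_map, coeff_zero_eq_constantCoeff]
    exact isUnit_iff_ne_zero.mpr ((map_ne_zero (Rat.castHom ℚ_[3])).mpr hΘ0)
  have hBZne : BZ ≠ 0 := fun h => hB0 (hιZinj (by rw [map_zero]; exact h))
  have hAZne : AZ ≠ 0 := fun h => hAne (hιZinj (by rw [map_zero]; exact h))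
  have hhcne : hc ≠ 0 := by
    intro h
    have h1 : constantCoeff (PowerSeries.map (Int.castRingHom ℤ_[3]) g) = 0 := by
      rw [hgZ, h, zero_pow three_ne_zero, map_zero]
    rw [← coeff_zero_eq_constantCoeff, coeff_map, coeff_zero_eq_constantCoeff, hEta.1, map_one] at h1
    exact one_ne_zero h1
  have hF : PowerSeries.map PadicInt.Coe.ringHom BZ ≠ 0 := fun h => hBZne (hκinj (by rw [map_zero]; exact h))
  have hG : PowerSeries.map PadicInt.Coe.ringHom (hc * AZ) ≠ 0 := fun h =>
    (mul_ne_zero hhcne hAZne) (hκinj (by rw [map_zero]; exact h))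
  obtain ⟨m, m', hmm⟩ := exists_mul_X_pow_mul_pow_eq_of_X_pow three_pos hΘ₃u hF hG hE1
  refine ⟨X ^ m' * (hc * AZ), X ^ m * BZ, mul_ne_zero (pow_ne_zero _ X_ne_zero) hBZne, ?_⟩
  rw [hΘ₃] at hmm
  simp only [map_mul, map_pow, PowerSeries.map_X]
  simp only [map_mul] at hmm
  exact hmm

/-! ### §4 LAW₃ ⟺ NOCUBE₃ (modulo K_geo₃), and NOCUBE₃ ⟹ `3 ∤ c` on the locus -/

/-- **LAW₃ at a datum from a non-cube.**  If `Θ_T` (the germ `z` has `z(0) = 0`) is NOT a cube in `Frac ℤ₃⟦q⟧`,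
then every cuspidal Kummer cube representative of `Θ_T` has an `η`-exponent `≢ 0 (mod 3)`. [folklore] -/
theorem exists_not_three_dvd_of_not_isThreeAdicFracCube (W : WeierstrassCurve ℚ) (c : ℤ) (X₀ Y₀ : ℚ)
    {z : ℚ⟦X⟧} (hz0 : constantCoeff z = 0) {N : ℕ} [NeZero N]
    (hnc : ¬ IsThreeAdicFracCube (kummerCubeSeries W c X₀ Y₀ z))
    {r : ℕ → ℤ} {g A B : ℤ⟦X⟧} (hrep : IsCuspidalKummerCubeRep N (kummerCubeSeries W c X₀ Y₀ z) r g A B) :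
    ∃ δ ∈ N.divisors, ¬ (3 : ℤ) ∣ r δ := by
  by_contra h
  push Not at h
  have hΘ0 : constantCoeff (kummerCubeSeries W c X₀ Y₀ z) ≠ 0 := by
    rw [constantCoeff_kummerCubeSeries W c X₀ Y₀ hz0]; norm_num
  exact hnc (isThreeAdicFracCube_of_forall_three_dvd hΘ0 hrep h)

/-- **NOCUBE₃ ⟹ LAW₃.**  If for every `X₀(N)`-optimal globally minimal `W` (lattice clause), `9 ∣ N`, every rational
point `(X₀, Y₀)` of order `3` of the short model `E_{W,c}` and the formal germ `z`, the tangent-line Kummer series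
`Θ_T` is NOT a cube in `Frac ℤ₃⟦q⟧` (NOCUBE₃, stated inline with LAW₃'s binders), then LAW₃
`CuspidalKummerCubeExponentLaw` holds.  CONDITIONAL edge; nothing about BSD is proved. [folklore] -/
theorem cuspidalKummerCubeExponentLaw_of_noCube
    (hNC : ∀ (W : WeierstrassCurve ℚ) [W.IsElliptic] [W.IsGloballyMinimal] {N : ℕ} [NeZero N]
      (D : ModularParametrizationData W N) (a : ℕ → ℤ), (∀ n, (a n : ℂ) = cuspCoeff D.f n) →
      9 ∣ N → (∀ z ∈ D.L.lattice, ∃ w ∈ periodLattice D.f, z = D.c * w) →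
      ∀ X₀ Y₀ : ℚ, IsShortThreeTorsion W D.c X₀ Y₀ →
      ∀ z : ℚ⟦X⟧, IsParamGerm W D.c a z → ¬ IsThreeAdicFracCube (kummerCubeSeries W D.c X₀ Y₀ z)) :
    CuspidalKummerCubeExponentLaw := by
  intro W _ _ N _ D a ha h9 hL X₀ Y₀ hT z hz r g A B hrep
  exact exists_not_three_dvd_of_not_isThreeAdicFracCube W D.c X₀ Y₀ hz.1 (hNC W D a ha h9 hL X₀ Y₀ hT z hz) hrep

/-- **LAW₃ ∧ K_geo₃ ⟹ NOCUBE₃.**  Granting LAW₃ and E-an-57 `CuspidalKummerCubeRepresentativeAtNine` (a cuspidal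
cube representative EXISTS), `Θ_T` is never a cube in `Frac ℤ₃⟦q⟧` on the locus of LAW₃: a cube would have all
exponents `≡ 0 (mod 3)` in the representative supplied by K_geo₃.  CONDITIONAL edge. [folklore] -/
theorem noCube_of_cuspidalKummerCubeExponentLaw_of_representative (hLaw : CuspidalKummerCubeExponentLaw)
    (h57 : CuspidalKummerCubeRepresentativeAtNine) :
    ∀ (W : WeierstrassCurve ℚ) [W.IsElliptic] [W.IsGloballyMinimal] {N : ℕ} [NeZero N]
      (D : ModularParametrizationData W N) (a : ℕ → ℤ), (∀ n, (a n : ℂ) = cuspCoeff D.f n) →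
      9 ∣ N → (∀ z ∈ D.L.lattice, ∃ w ∈ periodLattice D.f, z = D.c * w) →
      ∀ X₀ Y₀ : ℚ, IsShortThreeTorsion W D.c X₀ Y₀ →
      ∀ z : ℚ⟦X⟧, IsParamGerm W D.c a z → ¬ IsThreeAdicFracCube (kummerCubeSeries W D.c X₀ Y₀ z) := by
  intro W _ _ N _ D a ha h9 hL X₀ Y₀ hT z hz hcube
  obtain ⟨r, g, A, B, hrep⟩ := h57 W D a ha h9 hL X₀ Y₀ hT z hz
  obtain ⟨δ, hδ, hnd⟩ := hLaw W D a ha h9 hL X₀ Y₀ hT z hz r g A B hrep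
  have hΘ0 : constantCoeff (kummerCubeSeries W D.c X₀ Y₀ z) ≠ 0 := by
    rw [constantCoeff_kummerCubeSeries W D.c X₀ Y₀ hz.1]; norm_num
  exact hnd (forall_three_dvd_of_isThreeAdicFracCube hΘ0 hcube hrep δ hδ)

/-- **NOCUBE₃ ⟹ `3 ∤ c` on the rational-`3`-torsion locus**, directly through E-an-55 (`ManinThreeKummerCube_holds`,
p3: `3 ∣ c` cubes `Θ_T`) and the existence of the germ (`exists_isParamGerm`): for `X₀(N)`-optimal `W` with
`9 ∣ N` and a rational point of order `3` on `E_{W,c}`, `3 ∤ c`.  CONDITIONAL edge (NOCUBE₃ is the hypothesis);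
nothing about BSD or Manin's conjecture is proved. [cite: Honda1970, Thm. 2 (p. 223)] -/
theorem not_three_dvd_maninConstant_of_noCube
    (hNC : ∀ (W : WeierstrassCurve ℚ) [W.IsElliptic] [W.IsGloballyMinimal] {N : ℕ} [NeZero N]
      (D : ModularParametrizationData W N) (a : ℕ → ℤ), (∀ n, (a n : ℂ) = cuspCoeff D.f n) →
      9 ∣ N → (∀ z ∈ D.L.lattice, ∃ w ∈ periodLattice D.f, z = D.c * w) →
      ∀ X₀ Y₀ : ℚ, IsShortThreeTorsion W D.c X₀ Y₀ →
      ∀ z : ℚ⟦X⟧, IsParamGerm W D.c a z → ¬ IsThreeAdicFracCube (kummerCubeSeries W D.c X₀ Y₀ z))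
    (W : WeierstrassCurve ℚ) [W.IsElliptic] [W.IsGloballyMinimal] {N : ℕ} [NeZero N]
    (D : ModularParametrizationData W N) (h9 : 9 ∣ N)
    (hL : ∀ z ∈ D.L.lattice, ∃ w ∈ periodLattice D.f, z = D.c * w)
    {X₀ Y₀ : ℚ} (hT : IsShortThreeTorsion W D.c X₀ Y₀) : ¬ (3 : ℤ) ∣ D.c := by
  intro h3
  set a : ℕ → ℤ := fun n => W.LFunction n with ha_def
  have ha : ∀ n, (a n : ℂ) = cuspCoeff D.f n := fun n => (D.isNewformOf.2 n).symm
  obtain ⟨z, hz⟩ := exists_isParamGerm W D.c a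
  exact hNC W D a ha h9 hL X₀ Y₀ hT z hz (ManinThreeKummerCube_holds W D a ha h9 X₀ Y₀ hT z hz h3)

end Summit.BirchSwinnertonDyer.BirchSwinnertonDyer.Theorems.ManinLocalTwoThree

end
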